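import Literature.RepresentationTheory.HeisenbergGroup.DilationRepresentation
import Mathlib.Analysis.Distribution.SchwartzSpace.Deriv
import Mathlib.Analysis.Calculus.Deriv.Shift
import Mathlib.MeasureTheory.Measure.Lebesgue.EqHaar
import HarnessLib

/-!
# Schwartz functions are differentiable vectors of the dilation group on `L²(ℝ)`; generator `x d/dx + ½`

Topic `RepresentationTheory/HeisenbergGroup`; namespace
`Literature.RepresentationTheory.HeisenbergGroup.DilationModel` (that of `DilationRepresentation.lean`, whose
`dilationRep` this file specialises).

The unitary group `(ω(e^t) f)(x) = e^{t/2} f(e^t x)` on `L²(ℝ, dx)` is `dilationRep volume 1` of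
`DilationRepresentation.lean` along `t ↦ e^t ∈ ℝˣ` (modulus `e^t`, weight `e^{t/2}`) — the metaplectic
representation on the Levi factor of the Siegel parabolic for `n = 1`: G. B. Folland, *Harmonic Analysis in
Phase Space* [Folland1989], Chap. 4, formula (4.24) (held text `book:folland1989-harmonic-analysis-phase-space`,
p0157: `μ(diag(A, A*⁻¹)) f(x) = det^{-1/2}(A) f(A⁻¹x)`) and Theorem (4.45) (p0163 L41: "The Schwartz space
`𝒮(ℝⁿ)` consists of `C^∞` vectors for `μ`"), whose proof computes for `f ∈ 𝒮` (p0164)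
`d/dt [det^{-1/2}(e^{tA}) f(e^{-tA} x)]_{t=0} = -½ (tr A) f - Σ A_jk x_k ∂_j f`; for `n = 1`, `A = -1` this
is `d/dt [e^{t/2} f(e^t x)]_{t=0} = ½ f + x f'`, the generator `dilationGen` below.

WHAT IS REPRODUCED (kernel proofs, Mathlib + `DilationRepresentation.lean` only):
* §1 `expUnit t = e^t ∈ ℝˣ`, the modulus `distribHaarChar ℝ u = |u|`, the unitary group
  `dilationUnitary t = dilationRep volume 1 (e^t)` with `(ω(e^t) f)(x) = e^{t/2} f(e^t x)` a.e., group law;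
* §2 the dilations `schwartzDilate t : 𝓢(ℝ, ℂ) →L[ℂ] 𝓢(ℝ, ℂ)`, the generator `dilationGen = ½ + x d/dx`
  and the pointwise derivative `∂_t (e^{t/2} Φ(e^t x))`;
* §3 a uniform second-order Taylor bound: every seminorm `p_{i,0}` of the remainder
  `h⁻¹(schwartzDilate h Φ - Φ) - dilationGen Φ` is `O(|h|)` (`seminorm_dilationRem_le`), hence in `L²`;
* §4 THE RESULT `hasDerivAt_dilationUnitary`: `HasDerivAt (t ↦ ω(e^t) Φ) (ω(e^{t₀}) (dilationGen Φ)) t₀` in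
  `L²(ℝ)` for every Schwartz `Φ` and every `t₀`; on `𝓢` the unitary group acts by `schwartzDilate`.
Not here: higher derivatives / `C^∞` vectors, the subgroups of (4.25)–(4.26), `n > 1`.

## Provenance

Tree port (LEAN-IN-TREE, 2026-08-18) of the HodgeCM publication cell's package file
`HodgeCM/PerL34/ArchCOrbitDilation.lean` (unit `pub-hodgecm-pv06-g6`, gate run 30; statements and proofs verbatim
up to the renaming `U ↦ dilationUnitary`, `dil ↦ schwartzDilate`, `gen ↦ dilationGen`, `rem ↦ dilationRem`,
`scaleEquiv ↦ expScale`, namespace `HodgeCM.PerL34.ArchC.DilationToy` ↦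
`Literature.RepresentationTheory.HeisenbergGroup.DilationModel`), where it is the `L²(ℝ)` toy instance of a
"differentiable orbit" hypothesis; nothing problem-specific is ported.

## References

* [cite: Folland1989, Thm 4.45] G. B. Folland, *Harmonic Analysis in Phase Space*, Annals of Mathematics
  Studies 122, Princeton University Press, 1989 — Chap. 4, (4.24) and Theorem (4.45) with proof (pp. 163–164).
-/

set_option autoImplicit false

noncomputable section

open MeasureTheory SchwartzMap
open scoped ENNReal Pointwise NNReal Topology

namespace Literature.RepresentationTheory.HeisenbergGroup.DilationModel

/-! ## §1  The one-parameter subgroup `t ↦ e^t` of `ℝˣ` and the unitary dilation group on `L²(ℝ)` -/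

/-- the one-parameter subgroup `t ↦ e^t ∈ ℝˣ` [folklore] -/
def expUnit (t : ℝ) : ℝˣ := Units.mk0 (Real.exp t) (Real.exp_pos t).ne'

/-- `(expUnit t : ℝ) = e^t`. [folklore] -/
@[simp] theorem coe_expUnit (t : ℝ) : (expUnit t : ℝ) = Real.exp t := rfl

/-- `t ↦ e^t` is a one-parameter subgroup of `ℝˣ`. [folklore] -/
theorem expUnit_add (s t : ℝ) : expUnit (s + t) = expUnit s * expUnit t :=
  Units.ext (by simp [Real.exp_add])

/-- The action of `e^t ∈ ℝˣ` on `ℝ` is multiplication by `e^t`. [folklore] -/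
theorem expUnit_smul (t x : ℝ) : expUnit t • x = Real.exp t * x := by
  rw [Units.smul_def, smul_eq_mul, coe_expUnit]

/-- the module of a unit of `ℝ` acting on `(ℝ, dx)` by multiplication is its absolute value [folklore] -/
theorem distribHaarChar_real_units (u : ℝˣ) : distribHaarChar ℝ u = ‖(u : ℝ)‖₊ := by
  have h1 : (volume : Measure ℝ) (Set.Icc (0:ℝ) 1) ≠ 0 := by simp
  have h2 : (volume : Measure ℝ) (Set.Icc (0:ℝ) 1) ≠ ∞ := by simp
  refine distribHaarChar_eq_of_measure_smul_eq_mul (μ := volume) h1 h2 ?_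
  have hset : (u • Set.Icc (0:ℝ) 1 : Set ℝ) = (u : ℝ) • Set.Icc (0:ℝ) 1 := by
    ext y; simp only [Set.mem_smul_set, Units.smul_def]
  rw [hset, Measure.addHaar_smul, Module.finrank_self, pow_one, ← Real.norm_eq_abs, ofReal_norm]
  rfl

/-- the weight `ν(g) δ(g)^{1/2}` of `dilationRep` at `g = e^t`, `ν = 1`, is `e^{t/2}` [folklore] -/
theorem weight_expUnit (t : ℝ) : weight ℝ (1 : ℝˣ →* Circle) (expUnit t) = (Real.exp (t / 2) : ℂ) := by
  rw [weight, distribHaarChar_real_units, MonoidHom.one_apply, Circle.coe_one, one_mul]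
  congr 1
  rw [Real.coe_sqrt, coe_nnnorm, coe_expUnit, Real.norm_eq_abs, abs_of_pos (Real.exp_pos t)]
  have h2 : Real.exp t = Real.exp (t / 2) ^ 2 := by
    rw [← Real.exp_nat_mul]; congr 1; push_cast; ring
  rw [h2, Real.sqrt_sq (Real.exp_pos _).le]

/-- the unitary dilation `(dilationUnitary t f)(x) = e^{t/2} f(e^t x)` on `L²(ℝ)`, i.e.
`dilationRep volume 1 (e^t)` [folklore] -/
def dilationUnitary (t : ℝ) : Lp ℂ 2 (volume : Measure ℝ) ≃ₗᵢ[ℂ] Lp ℂ 2 (volume : Measure ℝ) :=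
  dilationRep volume (1 : ℝˣ →* Circle) (expUnit t)

/-- Unfolding `dilationUnitary`. [folklore] -/
theorem dilationUnitary_def (t : ℝ) :
    dilationUnitary t = dilationRep volume (1 : ℝˣ →* Circle) (expUnit t) := rfl

/-- The group law, applied to a vector. [folklore] -/
theorem dilationUnitary_add_apply (s t : ℝ) (f : Lp ℂ 2 (volume : Measure ℝ)) :
    dilationUnitary (s + t) f = dilationUnitary s (dilationUnitary t f) := by
  rw [dilationUnitary_def, expUnit_add, map_mul]; rfl

/-- `(dilationUnitary t f)(x) = e^{t/2} f(e^t x)` for a.e. `x` [folklore] -/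
theorem coeFn_dilationUnitary (t : ℝ) (f : Lp ℂ 2 (volume : Measure ℝ)) :
    ⇑(dilationUnitary t f) =ᵐ[volume] fun x => (Real.exp (t / 2) : ℂ) * f (Real.exp t * x) := by
  filter_upwards [coeFn_dilationRep volume (1 : ℝˣ →* Circle) (expUnit t) f] with x hx
  rw [dilationUnitary_def, hx, weight_expUnit, expUnit_smul]

/-! ## §2  The dilations on the Schwartz space and their generator `dilationGen = ½ + x d/dx` -/

/-- multiplication by `e^t` as a continuous linear automorphism of `ℝ` [folklore] -/
def expScale (t : ℝ) : ℝ ≃L[ℝ] ℝ :=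
  (LinearEquiv.smulOfNeZero ℝ ℝ (Real.exp t) (Real.exp_pos t).ne').toContinuousLinearEquiv

/-- `expScale t x = e^t x`. [folklore] -/
@[simp] theorem expScale_apply (t x : ℝ) : expScale t x = Real.exp t * x := rfl

/-- the dilation `(schwartzDilate t Φ)(x) = e^{t/2} Φ(e^t x)` as a continuous linear operator on `𝓢(ℝ, ℂ)`
[folklore] -/
def schwartzDilate (t : ℝ) : 𝓢(ℝ, ℂ) →L[ℂ] 𝓢(ℝ, ℂ) :=
  (Real.exp (t / 2) : ℂ) • compCLMOfContinuousLinearEquiv ℂ (expScale t)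

/-- `schwartzDilate_apply`. [folklore] -/
@[simp] theorem schwartzDilate_apply (t : ℝ) (Φ : 𝓢(ℝ, ℂ)) (x : ℝ) :
    schwartzDilate t Φ x = (Real.exp (t / 2) : ℂ) * Φ (Real.exp t * x) := by
  simp [schwartzDilate]

/-- `schwartzDilate 0 Φ x = Φ x`. [folklore] -/
@[simp] theorem schwartzDilate_zero_apply (Φ : 𝓢(ℝ, ℂ)) (x : ℝ) : schwartzDilate 0 Φ x = Φ x := by simp

/-- `schwartzDilate 0 = id`. [folklore] -/
theorem schwartzDilate_zero (Φ : 𝓢(ℝ, ℂ)) : schwartzDilate 0 Φ = Φ := by ext x; simp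

/-- the generator `dilationGen Φ = ½ Φ + x Φ'` of the dilation group, a continuous linear operator on
`𝓢(ℝ, ℂ)` [folklore] -/
def dilationGen : 𝓢(ℝ, ℂ) →L[ℂ] 𝓢(ℝ, ℂ) :=
  (1 / 2 : ℂ) • ContinuousLinearMap.id ℂ _ +
    (smulLeftCLM ℂ (fun x : ℝ => (x : ℂ))).comp (derivCLM ℂ ℂ)

/-- `dilationGen_apply`. [folklore] -/
@[simp] theorem dilationGen_apply (Φ : 𝓢(ℝ, ℂ)) (x : ℝ) :
    dilationGen Φ x = (1 / 2 : ℂ) * Φ x + (x : ℂ) * deriv Φ x := by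
  have h : Function.HasTemperateGrowth (fun x : ℝ => (x : ℂ)) := Complex.ofRealCLM.hasTemperateGrowth
  simp [dilationGen, smulLeftCLM_apply_apply h]

/-- POINTWISE ENGINE: for every `x`, `s ↦ (schwartzDilate s Φ)(x) = e^{s/2} Φ(e^s x)` is differentiable at
every `t`
with derivative `(schwartzDilate t (dilationGen Φ))(x) = e^{t/2} (½ Φ + y Φ')(e^t x)`. [folklore] -/
theorem hasDerivAt_schwartzDilate_apply (Φ : 𝓢(ℝ, ℂ)) (x t : ℝ) :
    HasDerivAt (fun s => schwartzDilate s Φ x) (schwartzDilate t (dilationGen Φ) x) t := by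
  have ha : HasDerivAt (fun s : ℝ => (Real.exp (s / 2) : ℂ)) ((Real.exp (t / 2) * (1 / 2) : ℝ) : ℂ) t := by
    refine HasDerivAt.ofReal_comp ?_
    have := ((hasDerivAt_id t).div_const 2).exp
    simpa using this
  have hu : HasDerivAt (fun s : ℝ => Real.exp s * x) (Real.exp t * x) t := by
    simpa using (Real.hasDerivAt_exp t).mul_const x
  have hΦ : HasDerivAt (fun s : ℝ => Φ (Real.exp s * x))
      ((Real.exp t * x) • deriv Φ (Real.exp t * x)) t :=
    HasDerivAt.scomp t (Φ.hasDerivAt (Real.exp t * x)) hu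
  have h := ha.mul hΦ
  have hfun : (fun s => schwartzDilate s Φ x) =
      (fun s => (Real.exp (s / 2) : ℂ)) * fun s => Φ (Real.exp s * x) := by
    funext s; simp only [Pi.mul_apply, schwartzDilate_apply]
  rw [hfun]
  refine h.congr_deriv ?_
  rw [schwartzDilate_apply, dilationGen_apply, Complex.real_smul]
  push_cast
  ring

/-! ## §3  The uniform Taylor bound in the Schwartz seminorms -/

/-- a two-step mean-value bound: if `φ` is twice differentiable with `‖φ''‖ ≤ C` on `|s| ≤ |h|`, then
`‖φ h − φ 0 − h • φ' 0‖ ≤ C h²` [folklore] -/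
theorem taylor_two_bound {E : Type*} [NormedAddCommGroup E] [NormedSpace ℝ E]
    {φ φ' φ'' : ℝ → E} {h C : ℝ} (h1 : ∀ s, HasDerivAt φ (φ' s) s)
    (h2 : ∀ s, HasDerivAt φ' (φ'' s) s)
    (hb : ∀ s, |s| ≤ |h| → ‖φ'' s‖ ≤ C) : ‖φ h - φ 0 - h • φ' 0‖ ≤ C * h ^ 2 := by
  have hC : 0 ≤ C := le_trans (norm_nonneg _) (hb 0 (by simp))
  have hSconv : Convex ℝ (Set.uIcc (0 : ℝ) h) := convex_uIcc 0 h
  have hmemS : ∀ s ∈ Set.uIcc (0 : ℝ) h, |s| ≤ |h| := by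
    intro s hs
    rcases Set.mem_uIcc.mp hs with ⟨h0s, hsh⟩ | ⟨hhs, hs0⟩
    · rw [abs_of_nonneg h0s, abs_of_nonneg (h0s.trans hsh)]; exact hsh
    · rw [abs_of_nonpos hs0, abs_of_nonpos (hhs.trans hs0)]; exact neg_le_neg hhs
  have hstep : ∀ s ∈ Set.uIcc (0 : ℝ) h, ‖φ' s - φ' 0‖ ≤ C * |h| := by
    intro s hs
    have := hSconv.norm_image_sub_le_of_norm_hasDerivWithin_le
      (fun u _ => (h2 u).hasDerivWithinAt) (fun u hu => hb u (hmemS u hu)) Set.left_mem_uIcc hs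
    refine this.trans ?_
    rw [sub_zero, Real.norm_eq_abs]
    exact mul_le_mul_of_nonneg_left (hmemS s hs) hC
  have hψ : ∀ s, HasDerivAt (fun s => φ s - φ 0 - s • φ' 0) (φ' s - φ' 0) s := by
    intro s
    have := ((h1 s).sub_const (φ 0)).sub ((hasDerivAt_id' s).smul_const (φ' 0))
    rw [one_smul] at this
    exact this
  have := hSconv.norm_image_sub_le_of_norm_hasDerivWithin_le
    (fun u _ => (hψ u).hasDerivWithinAt) hstep Set.left_mem_uIcc Set.right_mem_uIcc
  simp only [sub_self, zero_smul, sub_zero, Real.norm_eq_abs] at this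
  calc ‖φ h - φ 0 - h • φ' 0‖ ≤ C * |h| * |h| := this
    _ = C * h ^ 2 := by rw [mul_assoc, ← sq, sq_abs]

/-- the dilates by `e^s`, `|s| ≤ 1`, of a Schwartz function:
`|x|^i ‖(schwartzDilate s Ψ)(x)‖ ≤ e^{i+1/2} p_{i,0}(Ψ)` [folklore] -/
theorem norm_pow_mul_schwartzDilate_le (Ψ : 𝓢(ℝ, ℂ)) (i : ℕ) {s : ℝ} (hs : |s| ≤ 1) (x : ℝ) :
    |x| ^ i * ‖schwartzDilate s Ψ x‖ ≤ Real.exp (i + 1 / 2) * SchwartzMap.seminorm ℂ i 0 Ψ := by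
  have hy : |x| ^ i = Real.exp (-(s * i)) * |Real.exp s * x| ^ i := by
    rw [abs_mul, abs_of_pos (Real.exp_pos s), mul_pow, ← Real.exp_nat_mul, ← mul_assoc,
      ← Real.exp_add]
    ring_nf; simp
  have hsem : |Real.exp s * x| ^ i * ‖Ψ (Real.exp s * x)‖ ≤ SchwartzMap.seminorm ℂ i 0 Ψ := by
    have := SchwartzMap.norm_pow_mul_le_seminorm ℂ Ψ i (Real.exp s * x)
    rwa [Real.norm_eq_abs] at this
  have hexp : Real.exp (-(s * i)) * Real.exp (s / 2) ≤ Real.exp (i + 1 / 2) := by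
    rw [← Real.exp_add, Real.exp_le_exp]
    have h1 : -(s * i) ≤ (i : ℝ) := by
      have := abs_le.mp hs
      nlinarith [Nat.cast_nonneg (α := ℝ) i]
    have h2 : s / 2 ≤ 1 / 2 := by linarith [(abs_le.mp hs).2]
    linarith
  rw [schwartzDilate_apply, norm_mul, Complex.norm_real, Real.norm_eq_abs, abs_of_pos (Real.exp_pos _), hy]
  calc Real.exp (-(s * i)) * |Real.exp s * x| ^ i * (Real.exp (s / 2) * ‖Ψ (Real.exp s * x)‖)
      = (Real.exp (-(s * i)) * Real.exp (s / 2)) * (|Real.exp s * x| ^ i * ‖Ψ (Real.exp s * x)‖) := by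
        ring
    _ ≤ Real.exp (i + 1 / 2) * SchwartzMap.seminorm ℂ i 0 Ψ :=
        mul_le_mul hexp hsem (by positivity) (Real.exp_pos _).le

/-- the Schwartz-space remainder `dilationRem h Φ = h⁻¹ (schwartzDilate h Φ − Φ) − dilationGen Φ` of the
difference quotient [folklore] -/
def dilationRem (h : ℝ) (Φ : 𝓢(ℝ, ℂ)) : 𝓢(ℝ, ℂ) :=
  (h⁻¹ : ℂ) • (schwartzDilate h Φ - Φ) - dilationGen Φ

/-- Pointwise formula for the remainder. [folklore] -/
theorem dilationRem_apply (h : ℝ) (Φ : 𝓢(ℝ, ℂ)) (x : ℝ) :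
    dilationRem h Φ x = (h⁻¹ : ℂ) * (schwartzDilate h Φ x - Φ x) - dilationGen Φ x := rfl

/-- `h • dilationRem h Φ = schwartzDilate h Φ − Φ − h • dilationGen Φ`. [folklore] -/
theorem smul_dilationRem (h : ℝ) (hh : h ≠ 0) (Φ : 𝓢(ℝ, ℂ)) :
    (h : ℂ) • dilationRem h Φ = schwartzDilate h Φ - Φ - (h : ℂ) • dilationGen Φ := by
  have hh' : (h : ℂ) ≠ 0 := Complex.ofReal_ne_zero.mpr hh
  rw [dilationRem, smul_sub, smul_smul, mul_inv_cancel₀ hh', one_smul]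

/-- THE BOUND: `|x|^i ‖(dilationRem h Φ)(x)‖ ≤ |h| · e^{i+1/2} · p_{i,0}(dilationGen (dilationGen Φ))` for
`0 < |h| ≤ 1` [folklore] -/
theorem norm_pow_mul_dilationRem_le (Φ : 𝓢(ℝ, ℂ)) (i : ℕ) {h : ℝ} (hh : h ≠ 0) (hh1 : |h| ≤ 1)
    (x : ℝ) :
    |x| ^ i * ‖dilationRem h Φ x‖ ≤
      |h| * (Real.exp (i + 1 / 2) * SchwartzMap.seminorm ℂ i 0 (dilationGen (dilationGen Φ))) := by
  set K := Real.exp (i + 1 / 2) * SchwartzMap.seminorm ℂ i 0 (dilationGen (dilationGen Φ)) with hK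
  set c : ℂ := ((|x| ^ i : ℝ) : ℂ) with hc
  have hT := taylor_two_bound (E := ℂ) (h := h) (C := K)
    (φ := fun s => c * schwartzDilate s Φ x) (φ' := fun s => c * schwartzDilate s (dilationGen Φ) x)
    (φ'' := fun s => c * schwartzDilate s (dilationGen (dilationGen Φ)) x)
    (fun s => (hasDerivAt_schwartzDilate_apply Φ x s).const_mul c)
    (fun s => (hasDerivAt_schwartzDilate_apply (dilationGen Φ) x s).const_mul c)
    (fun s hs => by
      rw [norm_mul, hc, Complex.norm_real, Real.norm_eq_abs, abs_pow, abs_abs]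
      exact norm_pow_mul_schwartzDilate_le (dilationGen (dilationGen Φ)) i (hs.trans hh1) x)
  have hh' : (h : ℂ) ≠ 0 := Complex.ofReal_ne_zero.mpr hh
  have hlhs : c * schwartzDilate h Φ x - c * schwartzDilate 0 Φ x - h • (c * schwartzDilate 0 (dilationGen Φ) x)
      = ((|x| ^ i * h : ℝ) : ℂ) * dilationRem h Φ x := by
    rw [schwartzDilate_zero_apply, schwartzDilate_zero_apply, dilationRem_apply, Complex.real_smul, hc]
    push_cast
    field_simp
  rw [hlhs, norm_mul, Complex.norm_real, Real.norm_eq_abs, abs_mul, abs_pow, abs_abs] at hT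
  have hpos : 0 < |h| := abs_pos.mpr hh
  have : |x| ^ i * ‖dilationRem h Φ x‖ * |h| ≤ |h| * K * |h| := by
    calc |x| ^ i * ‖dilationRem h Φ x‖ * |h| = |x| ^ i * |h| * ‖dilationRem h Φ x‖ := by ring
      _ ≤ K * h ^ 2 := hT
      _ = |h| * K * |h| := by rw [← sq_abs]; ring
  exact le_of_mul_le_mul_right this hpos

/-- every Schwartz seminorm `p_{i,0}` of the remainder is `O(|h|)` [folklore] -/
theorem seminorm_dilationRem_le (Φ : 𝓢(ℝ, ℂ)) (i : ℕ) {h : ℝ} (hh : h ≠ 0) (hh1 : |h| ≤ 1) :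
    SchwartzMap.seminorm ℂ i 0 (dilationRem h Φ) ≤
      |h| * (Real.exp (i + 1 / 2) * SchwartzMap.seminorm ℂ i 0 (dilationGen (dilationGen Φ))) := by
  refine SchwartzMap.seminorm_le_bound ℂ i 0 (dilationRem h Φ) (by positivity) fun x => ?_
  rw [norm_iteratedFDeriv_zero, Real.norm_eq_abs]
  exact norm_pow_mul_dilationRem_le Φ i hh hh1 x

/-- the `L²` norm of the remainder is `O(|h|)`: `‖(dilationRem h Φ).toLp 2‖ ≤ C |h|` for `0 < |h| ≤ 1`
[folklore] -/
theorem norm_toLp_dilationRem_le (Φ : 𝓢(ℝ, ℂ)) :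
    ∃ C : ℝ, 0 ≤ C ∧ ∀ h : ℝ, h ≠ 0 → |h| ≤ 1 →
      ‖(dilationRem h Φ).toLp 2 (volume : Measure ℝ)‖ ≤ C * |h| := by
  obtain ⟨k, C, hC0, hC⟩ := SchwartzMap.norm_toLp_le_seminorm ℂ ℂ (2 : ℝ≥0∞) (volume : Measure ℝ)
  set K : ℝ := Real.exp (k + 1 / 2) *
    ∑ i ∈ Finset.range (k + 1), SchwartzMap.seminorm ℂ i 0 (dilationGen (dilationGen Φ)) with hK
  have hK0 : 0 ≤ K := by positivity
  refine ⟨C * K, mul_nonneg hC0 hK0, fun h hh hh1 => ?_⟩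
  refine (hC (dilationRem h Φ)).trans ?_
  rw [mul_assoc]
  refine mul_le_mul_of_nonneg_left ?_ hC0
  refine Seminorm.finset_sup_apply_le (by positivity) fun m hm => ?_
  obtain ⟨hm1, hm2⟩ : m.1 ≤ k ∧ m.2 ≤ 0 := Finset.mem_Iic.mp hm
  have hm2' : m.2 = 0 := Nat.le_zero.mp hm2
  have hfam : schwartzSeminormFamily ℂ ℝ ℂ m = SchwartzMap.seminorm ℂ m.1 0 := by
    rw [← hm2']; rfl
  rw [hfam]
  refine (seminorm_dilationRem_le Φ m.1 hh hh1).trans ?_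
  rw [mul_comm |h| _]
  refine mul_le_mul_of_nonneg_right ?_ (abs_nonneg h)
  refine mul_le_mul ?_ ?_ (by positivity) (by positivity)
  · have hm1' : (m.1 : ℝ) ≤ k := by exact_mod_cast hm1
    exact Real.exp_le_exp.mpr (by linarith)
  · exact Finset.single_le_sum (f := fun i => SchwartzMap.seminorm ℂ i 0 (dilationGen (dilationGen Φ)))
      (fun i _ => apply_nonneg _ _) (Finset.mem_range.mpr (Nat.lt_succ_of_le hm1))

/-! ## §4  The `L²` derivative of the unitary dilation group on Schwartz vectors -/

/-- `toLp` is linear (Mathlib's `toLpCLM`), in the form needed here [folklore] -/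
theorem toLp_sub_sub_smul (Φ Ψ Ξ : 𝓢(ℝ, ℂ)) (c : ℂ) :
    (Φ - Ψ - c • Ξ).toLp 2 (volume : Measure ℝ) =
      Φ.toLp 2 volume - Ψ.toLp 2 volume - c • Ξ.toLp 2 volume := by
  simp only [← SchwartzMap.toLpCLM_apply (𝕜 := ℂ), map_sub, map_smul]

/-- `toLp` commutes with scalars. [folklore] -/
theorem toLp_smul (c : ℂ) (Φ : 𝓢(ℝ, ℂ)) :
    (c • Φ).toLp 2 (volume : Measure ℝ) = c • Φ.toLp 2 volume := by
  simp only [← SchwartzMap.toLpCLM_apply (𝕜 := ℂ), map_smul]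

/-- on the Schwartz space the unitary dilation IS `schwartzDilate`:
`dilationUnitary t Φ = schwartzDilate t Φ` in `L²(ℝ)` [folklore] -/
theorem toLp_schwartzDilate (t : ℝ) (Φ : 𝓢(ℝ, ℂ)) :
    dilationUnitary t (Φ.toLp 2 (volume : Measure ℝ)) = (schwartzDilate t Φ).toLp 2 volume := by
  apply Lp.ext
  have h1 := coeFn_dilationUnitary t (Φ.toLp 2 (volume : Measure ℝ))
  have h2 : (fun x => (Φ.toLp 2 (volume : Measure ℝ) : ℝ → ℂ) (Real.exp t * x)) =ᵐ[volume]
      fun x => Φ (Real.exp t * x) := by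
    have hq := (quasiMeasurePreserving_smul' (volume : Measure ℝ) (expUnit t)).ae_eq_comp
      (SchwartzMap.coeFn_toLp Φ 2 (volume : Measure ℝ))
    simpa only [Function.comp_def, expUnit_smul] using hq
  have h3 := SchwartzMap.coeFn_toLp (schwartzDilate t Φ) 2 (volume : Measure ℝ)
  filter_upwards [h1, h2, h3] with x hx1 hx2 hx3
  rw [hx1, hx2, hx3, schwartzDilate_apply]

/-- At `t₀ = 0`, Schwartz form: `t ↦ schwartzDilate t Φ` is differentiable at `0` IN `L²(ℝ)` with derivative
`dilationGen Φ = ½ Φ + x Φ'` [folklore] -/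
theorem hasDerivAt_toLp_schwartzDilate_zero (Φ : 𝓢(ℝ, ℂ)) :
    HasDerivAt (fun t : ℝ => (schwartzDilate t Φ).toLp 2 (volume : Measure ℝ))
      ((dilationGen Φ).toLp 2 volume) 0 := by
  obtain ⟨C, hC0, hC⟩ := norm_toLp_dilationRem_le Φ
  rw [hasDerivAt_iff_isLittleO_nhds_zero]
  refine Asymptotics.isLittleO_iff.mpr fun ε hε => ?_
  have hδ : 0 < min 1 (ε / (C + 1)) := lt_min one_pos (div_pos hε (by linarith))
  filter_upwards [Metric.ball_mem_nhds (0 : ℝ) hδ] with h hhδ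
  rw [Metric.mem_ball, dist_zero_right, Real.norm_eq_abs, lt_min_iff] at hhδ
  rcases eq_or_ne h 0 with rfl | hh
  · simp [schwartzDilate_zero]
  have hsm : (h • (dilationGen Φ).toLp 2 (volume : Measure ℝ) : Lp ℂ 2 (volume : Measure ℝ))
      = (h : ℂ) • (dilationGen Φ).toLp 2 volume := RCLike.real_smul_eq_coe_smul (K := ℂ) h _
  have key : (schwartzDilate (0 + h) Φ).toLp 2 (volume : Measure ℝ) - (schwartzDilate 0 Φ).toLp 2 volume
        - (h : ℂ) • (dilationGen Φ).toLp 2 volume = (h : ℂ) • (dilationRem h Φ).toLp 2 volume := by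
    rw [zero_add, schwartzDilate_zero, ← toLp_smul (h : ℂ) (dilationRem h Φ), smul_dilationRem h hh,
      toLp_sub_sub_smul]
  rw [hsm, key, norm_smul, Complex.norm_real, Real.norm_eq_abs]
  calc |h| * ‖(dilationRem h Φ).toLp 2 (volume : Measure ℝ)‖ ≤ |h| * (C * |h|) :=
        mul_le_mul_of_nonneg_left (hC h hh hhδ.1.le) (abs_nonneg h)
    _ = (C * |h|) * |h| := by ring
    _ ≤ ε * |h| := by
        refine mul_le_mul_of_nonneg_right ?_ (abs_nonneg h)
        have : C * |h| ≤ C * (ε / (C + 1)) := mul_le_mul_of_nonneg_left hhδ.2.le hC0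
        refine this.trans ?_
        rw [mul_div_assoc']
        exact (div_le_iff₀ (by linarith)).mpr (by nlinarith)

/-- At `t₀ = 0` for the unitary group: `HasDerivAt (t ↦ dilationUnitary t Φ) (dilationGen Φ) 0` in `L²(ℝ)`
[folklore] -/
theorem hasDerivAt_dilationUnitary_zero (Φ : 𝓢(ℝ, ℂ)) :
    HasDerivAt (fun t : ℝ => dilationUnitary t (Φ.toLp 2 (volume : Measure ℝ)))
      ((dilationGen Φ).toLp 2 volume) 0 := by
  have hfun : (fun t : ℝ => dilationUnitary t (Φ.toLp 2 (volume : Measure ℝ)))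
      = fun t => (schwartzDilate t Φ).toLp 2 volume := funext fun t => toLp_schwartzDilate t Φ
  rw [hfun]; exact hasDerivAt_toLp_schwartzDilate_zero Φ

/-- **At every `t₀`**: `HasDerivAt (t ↦ ω(e^t) Φ) (ω(e^{t₀}) (½ Φ + x Φ')) t₀` in `L²(ℝ)`, by the group law
and the continuity of the unitary `ω(e^{t₀})` (Folland 1989, Thm (4.45), `n = 1` Levi case). [folklore] -/
theorem hasDerivAt_dilationUnitary (Φ : 𝓢(ℝ, ℂ)) (t₀ : ℝ) :
    HasDerivAt (fun t : ℝ => dilationUnitary t (Φ.toLp 2 (volume : Measure ℝ)))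
      (dilationUnitary t₀ ((dilationGen Φ).toLp 2 volume)) t₀ := by
  have hfun : (fun t : ℝ => dilationUnitary t (Φ.toLp 2 (volume : Measure ℝ)))
      = fun t => dilationUnitary t₀ (dilationUnitary (t - t₀) (Φ.toLp 2 volume)) := by
    funext t; rw [← dilationUnitary_add_apply, show t₀ + (t - t₀) = t by ring]
  rw [hfun]
  have hin : HasDerivAt
      (fun t : ℝ => dilationUnitary (t - t₀) (Φ.toLp 2 (volume : Measure ℝ)))
      ((dilationGen Φ).toLp 2 volume) t₀ :=
    HasDerivAt.comp_sub_const
      (f := fun s : ℝ => dilationUnitary s (Φ.toLp 2 (volume : Measure ℝ))) t₀ t₀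
      (by rw [sub_self]; exact hasDerivAt_dilationUnitary_zero Φ)
  exact ((dilationUnitary t₀).toContinuousLinearEquiv.toContinuousLinearMap.restrictScalars ℝ).hasFDerivAt
    |>.comp_hasDerivAt t₀ hin

end Literature.RepresentationTheory.HeisenbergGroup.DilationModel
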